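import Literature.AlgebraicGeometry.HodgeTheory.MonodromyMumfordTateHeredity
import Literature.AlgebraicGeometry.HodgeTheory.GriffithsHolomorphicHodgeSubbundlesQPHolds
import Literature.AlgebraicGeometry.HodgeTheory.AlgebraicMonodromyMumfordTateOfQuasiProjective
import Literature.AlgebraicGeometry.HodgeTheory.HodgeGenericQbarDescentFiniteMonodromyInputs
import Literature.AlgebraicGeometry.HodgeTheory.InvariantClassesFromTotalSpaceProofs
import Literature.AlgebraicGeometry.HodgeTheory.QbarFamilyLocalSystem
import HarnessLib

/-!
# Heredity along CURVES for every smooth projective family (unconditional): «a finite-index subgroup of the monodromy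
# group lies in the Mumford–Tate group» at ONE member of an algebraic one-parameter sub-family ⇒ the same at ALL BUT
# COUNTABLY MANY members (CMSP (15.7) + Griffiths' holomorphy of the Hodge bundles, now a tree theorem; NO Cattani–Deligne–Kaplan)

Family `hodge`, layer `Literature/AlgebraicGeometry/HodgeTheory`. THEOREMS only (no definition, no named fact). Written by
the prover seat `hodge-nonav-prover-Ax` (g16, cell `hodge-nonav`), programme «HEREDITY», the generic curve form of the
route-A file `Summits/…/CyclicUnitaryPowersHeredityAlongCurves` (which uses weight-two frames instead of Griffiths).

SETTING. `π : 𝒳 ⟶ S` a smooth projective family of relative dimension `n` with `𝒳` and `S` quasi-projective and `S` smooth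
(`hU` its local triviality over `S(ℂ)`), degree `k`, Hodge-symmetric models `A`; FI(t) := «some finite-index subgroup of the
monodromy group `Γ_t = ratMonodromyGroup π k hU t` lies in `MT(Hᵏ(X_t))(ℚ)`». `P` a smooth quasi-projective CURVE
with `P(ℂ)` path connected, `g : P ⟶ S` (an algebraic one-parameter sub-family `π' = 𝒳 ×_S P → P`).

* `exists_countable_finiteIndex_le_mumfordTateGroup_of_curve` — FI(g c₀) for ONE `c₀ ∈ P(ℂ)` ⇒ a COUNTABLE `C ⊆ P(ℂ)` with
  FI(g c) for every `c ∉ C`. Proof: the non-Hodge-generic points of `π'` over the curve `P` are countable by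
  `exists_countable_isHodgeGenericPoint_of_griffiths1968QP_curve` fed with the THEOREM
  `griffiths1968_holomorphicHodgeSubbundlesQP_holds` (programme GRIFFITHS-HOLOMORPHY of the cell, prover-Bx); rational transports
  of `π'` exist along paths (`isRationalClass_transportFun_of_isSmoothProjectiveFamily`); HEREDITY H1
  `exists_finiteIndex_le_mumfordTateGroup_map_of_isHodgeGenericPoint_familyPullback` (CMSP (15.7)). NO hypothesis on the
  monodromy of the sub-family.
* `glIdentityComponent_subset_mumfordTateGroup_offCountable_of_curve` — the identity-component currency:
  `(Γ_{g c}^Zar)° ⊆ MT(Hᵏ(𝒳_{g c}))` off `C`.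
* `exists_countable_finiteIndex_le_mumfordTateGroup_of_curve_of_isHodgeGenericPoint` — the same through a HODGE-GENERIC point
  `g c₀` of `π` (Deligne's lemma, tree theorem, supplies FI; `S` irreducible).

HONEST FRAMING: unconditional (axioms standard), structural; the countable set is unspecified and FI at the seed is a
hypothesis; no statement about the Hodge conjecture; the Cattani–Deligne–Kaplan floor of «very general = off a countable union
of ALGEBRAIC subvarieties of the WHOLE base» is untouched.

## References
* [CarlsonMullerStachPeters2017] J. Carlson, S. Müller-Stach, C. Peters, *Period Mappings and Period Domains*, 2nd ed.,
  §15.3 (15.7), Lemma–Definition 15.3.7.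
* [Griffiths1968PeriodsII] P. Griffiths, Periods of integrals on algebraic manifolds II, Amer. J. Math. 90 (1968), Thm. 1.1.
* [VoisinHodgeI2002] C. Voisin, *Hodge Theory and Complex Algebraic Geometry I*, §10.2.1 Thm. 10.3.
* [Deligne1972WeilK3] P. Deligne, La conjecture de Weil pour les surfaces K3, Invent. Math. 15 (1972), Prop. 7.5.
* [VoisinHodgeII2003] C. Voisin, *Hodge Theory and Complex Algebraic Geometry II*, §3.1.2.
-/

noncomputable section

namespace Literature.AlgebraicGeometry.HodgeTheory

open CategoryTheory _root_.AlgebraicGeometry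
open _root_.Topology
open Literature.AlgebraicGeometry.Motives
open Literature.AlgebraicTopology.SingularHomology

variable [HodgeTensorFacts.{0, 0}] {𝒳 S P : SchemeOver ℂ} (π : 𝒳 ⟶ S) (n k : ℕ)
  (hf : IsSmoothProjectiveFamily π n) (hS : IsQuasiProjectiveOver S) (hSs : Smooth S.hom)
  (A : ∀ t : ComplexPoints S, HodgeModel n (fiberOver π t)) (hA : ∀ t, (A t).IsHodgeSymmetric)
  [∀ t : ComplexPoints S, Module.Finite ℚ (singularCohomology ℚ ℚ (ComplexPoints (fiberOver π t)) k)]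
  [SmoothOfRelativeDimension 1 P.hom]
  [PathConnectedSpace (ComplexPoints P)] (g : P ⟶ S)

/-- **HEREDITY ALONG CURVES, for every smooth projective family** (unconditional). `π : 𝒳 ⟶ S` smooth projective with `𝒳`, `S`
quasi-projective, `S` smooth; `P` a smooth quasi-projective curve with `P(ℂ)` path connected (no irreducibility needed); `g : P ⟶ S`. If at ONE
point `c₀` some finite-index subgroup of the monodromy group `Γ_{g c₀}` of `π` lies in `MT(Hᵏ(𝒳_{g c₀}))(ℚ)` (hypothesis `hFI`, stated
at a point `t₀ = g c₀`), then there is a COUNTABLE `C ⊆ P(ℂ)` such that the same holds at `g c` for every `c ∉ C`.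
[cite: CarlsonMullerStachPeters2017, §15.3 (15.7) and Lemma–Definition 15.3.7] [cite: Griffiths1968PeriodsII, Thm. 1.1]
[cite: VoisinHodgeI2002, §10.2.1 Thm. 10.3] [cite: VoisinHodgeII2003, §3.1.2] -/
theorem exists_countable_finiteIndex_le_mumfordTateGroup_of_curve (h𝒳 : IsQuasiProjectiveOver 𝒳)
    (hPq : IsQuasiProjectiveOver P) (c₀ : ComplexPoints P) (t₀ : ComplexPoints S)
    (ht₀ : AlgPoints.map g c₀ = t₀)
    (hFI : letI hU := isCohomologicallyLocallyTrivialOn_univ_of_isQuasiProjectiveOver π hf hS hSs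
      ∃ Γ₀ : Subgroup (singularCohomology ℚ ℚ (ComplexPoints (fiberOver π t₀)) k ≃ₗ[ℚ]
          singularCohomology ℚ ℚ (ComplexPoints (fiberOver π t₀)) k),
        Γ₀ ≤ ratMonodromyGroup π k hU ⟨t₀, Set.mem_univ _⟩ ∧
        (Γ₀.subgroupOf (ratMonodromyGroup π k hU ⟨t₀, Set.mem_univ _⟩)).FiniteIndex ∧
        Γ₀ ≤ ((A t₀).hodgeStructure (hf.isSmoothProjective t₀) (hA t₀) k).mumfordTateGroup) :
    letI hU := isCohomologicallyLocallyTrivialOn_univ_of_isQuasiProjectiveOver π hf hS hSs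
    ∃ C : Set (ComplexPoints P), C.Countable ∧ ∀ c : ComplexPoints P, c ∉ C →
      ∃ Γ₁ : Subgroup (singularCohomology ℚ ℚ (ComplexPoints (fiberOver π (AlgPoints.map g c))) k ≃ₗ[ℚ]
          singularCohomology ℚ ℚ (ComplexPoints (fiberOver π (AlgPoints.map g c))) k),
        Γ₁ ≤ ratMonodromyGroup π k hU ⟨AlgPoints.map g c, Set.mem_univ _⟩ ∧
        (Γ₁.subgroupOf (ratMonodromyGroup π k hU ⟨AlgPoints.map g c, Set.mem_univ _⟩)).FiniteIndex ∧
        Γ₁ ≤ ((A (AlgPoints.map g c)).hodgeStructure (hf.isSmoothProjective (AlgPoints.map g c))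
          (hA (AlgPoints.map g c)) k).mumfordTateGroup := by
  subst ht₀
  have hU := isCohomologicallyLocallyTrivialOn_univ_of_isQuasiProjectiveOver π hf hS hSs
  haveI := hSs
  haveI : IsSeparated S.hom := hS.isVarietyPair_ofScheme.isSeparated
  haveI hPs : Smooth P.hom := SmoothOfRelativeDimension.smooth 1 _
  -- ### the pulled-back family over the curve
  have hf' : IsSmoothProjectiveFamily (familyPullback.snd π g) n := hf.familyPullback_snd g
  have hU' := isCohomologicallyLocallyTrivialOn_univ_of_isQuasiProjectiveOver (familyPullback.snd π g) hf' hPq inferInstance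
  have h𝒳' : IsQuasiProjectiveOver (familyPullback π g) := isQuasiProjectiveOver_familyPullback_of_isSeparated π g h𝒳 hPq
  haveI : ∀ c : ComplexPoints P, Module.Finite ℚ (singularCohomology ℚ ℚ (ComplexPoints (fiberOver (familyPullback.snd π g) c)) k) :=
    fun c => BettiUniverse.finite (hf'.isSmoothProjective c) k
  -- real (hence Hodge-symmetric) Hodge models of its fibres
  have hAm' := fun c : ComplexPoints P => exists_isReal_hodgeModel_holds.exists_isHodgeSymmetric (hf'.isSmoothProjective c)
  let A' : ∀ c : ComplexPoints P, HodgeModel n (fiberOver (familyPullback.snd π g) c) := fun c => (hAm' c).choose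
  have hA' : ∀ c, (A' c).IsHodgeSymmetric := fun c => (hAm' c).choose_spec
  -- ### Griffiths (the cell's theorem): the non-Hodge-generic points of the curve family are countable
  obtain ⟨C, hCc, hgen⟩ := exists_countable_isHodgeGenericPoint_of_griffiths1968QP_curve
    griffiths1968_holomorphicHodgeSubbundlesQP_holds (familyPullback.snd π g) n k hf' hPq h𝒳' hU' A' hA'
  refine ⟨C, hCc, fun c hc => ?_⟩
  have hgenc := hgen ⟨c, Set.mem_univ _⟩ hc
  -- ### a path `c ⇝ c₀` in `P(ℂ)` and the rational transport of `π'` along it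
  let γ : Path c c₀ := PathConnectedSpace.somePath c c₀
  let γ' : Path (⟨c, Set.mem_univ _⟩ : (Set.univ : Set (ComplexPoints P))) ⟨c₀, Set.mem_univ _⟩ :=
    γ.map (f := fun x : ComplexPoints P => (⟨x, Set.mem_univ x⟩ : (Set.univ : Set (ComplexPoints P))))
      (continuous_id.subtype_mk _)
  have hrat' : ∀ (s t : (Set.univ : Set (ComplexPoints P))) (δ : Path.Homotopic.Quotient s t)
      (α : complexBetti (fiberOver (familyPullback.snd π g) s.1) k),
      IsRationalClass α → IsRationalClass (transportFun (familyPullback.snd π g) k hU' δ α) :=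
    fun s t δ α hα => isRationalClass_transportFun_of_isSmoothProjectiveFamily _ k 1 hf' hPq δ hα
  obtain ⟨T', hT'⟩ := exists_ratTransport (familyPullback.snd π g) k hU' hrat' ⟦γ'⟧
  -- ### HEREDITY H1 along the base change `g`
  exact exists_finiteIndex_le_mumfordTateGroup_map_of_isHodgeGenericPoint_familyPullback π g k hU hU' hf A hA A' hA' hgenc hT' hFI

/-- **Identity-component currency**: under the hypotheses of `exists_countable_finiteIndex_le_mumfordTateGroup_of_curve`, off the
countable `C` the identity component `(Γ_{g c}^Zar)°` of the Zariski closure of the monodromy group of `π` at `g c` lies in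
`MT(Hᵏ(𝒳_{g c}))(ℚ)` (`glIdentityComponent_subset_of_finiteIndex` + `glZariskiClosure_subset_mumfordTateGroup`). The shape consumed by
`signModel_of_identityComponent_le_mumfordTate` (route `SignSymmetricPowers`). [cite: CarlsonMullerStachPeters2017, Lemma–Definition 15.3.7]
[cite: Griffiths1968PeriodsII, Thm. 1.1] -/
theorem glIdentityComponent_subset_mumfordTateGroup_offCountable_of_curve (h𝒳 : IsQuasiProjectiveOver 𝒳)
    (hPq : IsQuasiProjectiveOver P) (c₀ : ComplexPoints P) (t₀ : ComplexPoints S)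
    (ht₀ : AlgPoints.map g c₀ = t₀)
    (hFI : letI hU := isCohomologicallyLocallyTrivialOn_univ_of_isQuasiProjectiveOver π hf hS hSs
      ∃ Γ₀ : Subgroup (singularCohomology ℚ ℚ (ComplexPoints (fiberOver π t₀)) k ≃ₗ[ℚ]
          singularCohomology ℚ ℚ (ComplexPoints (fiberOver π t₀)) k),
        Γ₀ ≤ ratMonodromyGroup π k hU ⟨t₀, Set.mem_univ _⟩ ∧
        (Γ₀.subgroupOf (ratMonodromyGroup π k hU ⟨t₀, Set.mem_univ _⟩)).FiniteIndex ∧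
        Γ₀ ≤ ((A t₀).hodgeStructure (hf.isSmoothProjective t₀) (hA t₀) k).mumfordTateGroup) :
    letI hU := isCohomologicallyLocallyTrivialOn_univ_of_isQuasiProjectiveOver π hf hS hSs
    ∃ C : Set (ComplexPoints P), C.Countable ∧ ∀ c : ComplexPoints P, c ∉ C →
      glIdentityComponent (ratMonodromyGroup π k hU ⟨AlgPoints.map g c, Set.mem_univ _⟩) ⊆
        (((A (AlgPoints.map g c)).hodgeStructure (hf.isSmoothProjective (AlgPoints.map g c))
            (hA (AlgPoints.map g c)) k).mumfordTateGroup : Set _) := by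
  obtain ⟨C, hCc, hC⟩ := exists_countable_finiteIndex_le_mumfordTateGroup_of_curve π n k hf hS hSs A hA g h𝒳 hPq c₀ t₀ ht₀ hFI
  refine ⟨C, hCc, fun c hc => ?_⟩
  obtain ⟨Γ₁, hle, hfi, hMT⟩ := hC c hc
  exact (glIdentityComponent_subset_of_finiteIndex hle hfi).trans (glZariskiClosure_subset_mumfordTateGroup _ hMT)

/-- **Every algebraic curve through a HODGE-GENERIC point**: if `S` is irreducible and `g c₀` is a Hodge-generic point of `π`
(`IsHodgeGenericPoint`), Deligne's lemma (CMSP Lemma–Def. 15.3.7 (i), tree theorem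
`deligne_finiteIndex_monodromy_le_mumfordTateGroup_of_isQuasiProjectiveOver`) supplies FI at `g c₀` and
`exists_countable_finiteIndex_le_mumfordTateGroup_of_curve` applies: FI at `g c` for all but countably many `c ∈ P(ℂ)`.
[cite: CarlsonMullerStachPeters2017, Definition 15.3.5 and Lemma–Definition 15.3.7] [cite: Deligne1972WeilK3, Prop. 7.5]
[cite: Griffiths1968PeriodsII, Thm. 1.1] -/
theorem exists_countable_finiteIndex_le_mumfordTateGroup_of_curve_of_isHodgeGenericPoint (h𝒳 : IsQuasiProjectiveOver 𝒳)
    (hPq : IsQuasiProjectiveOver P) (hirr : IrreducibleSpace S.left)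
    (c₀ : ComplexPoints P)
    (hgen : letI hU := isCohomologicallyLocallyTrivialOn_univ_of_isQuasiProjectiveOver π hf hS hSs
      IsHodgeGenericPoint π k hU hf A hA ⟨AlgPoints.map g c₀, Set.mem_univ _⟩) :
    letI hU := isCohomologicallyLocallyTrivialOn_univ_of_isQuasiProjectiveOver π hf hS hSs
    ∃ C : Set (ComplexPoints P), C.Countable ∧ ∀ c : ComplexPoints P, c ∉ C →
      ∃ Γ₁ : Subgroup (singularCohomology ℚ ℚ (ComplexPoints (fiberOver π (AlgPoints.map g c))) k ≃ₗ[ℚ]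
          singularCohomology ℚ ℚ (ComplexPoints (fiberOver π (AlgPoints.map g c))) k),
        Γ₁ ≤ ratMonodromyGroup π k hU ⟨AlgPoints.map g c, Set.mem_univ _⟩ ∧
        (Γ₁.subgroupOf (ratMonodromyGroup π k hU ⟨AlgPoints.map g c, Set.mem_univ _⟩)).FiniteIndex ∧
        Γ₁ ≤ ((A (AlgPoints.map g c)).hodgeStructure (hf.isSmoothProjective (AlgPoints.map g c))
          (hA (AlgPoints.map g c)) k).mumfordTateGroup := by
  have hU := isCohomologicallyLocallyTrivialOn_univ_of_isQuasiProjectiveOver π hf hS hSs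
  have hFI := (deligne_finiteIndex_monodromy_le_mumfordTateGroup_of_isQuasiProjectiveOver π n k hf h𝒳 hS hSs hirr hU A hA
    ⟨AlgPoints.map g c₀, Set.mem_univ _⟩ hgen).1
  exact exists_countable_finiteIndex_le_mumfordTateGroup_of_curve π n k hf hS hSs A hA g h𝒳 hPq c₀ _ rfl hFI

end Literature.AlgebraicGeometry.HodgeTheory

end
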